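import Mathlib
import Summits.KontsevichZagierPeriods.Zeta5Search.Families.CellularIntegral
import Summits.KontsevichZagierPeriods.Zeta5Search.Families.BasicConvergence
import Summits.KontsevichZagierPeriods.Zeta5Search.Families.ChordCrossings
import Summits.KontsevichZagierPeriods.Zeta5Search.Families.BasicConvergenceGeneral
import Summits.KontsevichZagierPeriods.Zeta5Search.Families.ConvergentSymmetries
import HarnessLib

/-!
# ζ(5) search — Families: Brown's chord valuations and convergence polytopes are invariant under relabeling by the dihedral groups (general exponents)

HONEST FRAMING: systematic search; no irrationality claim unless certified.

Cell `pub-zeta5`, seat P2.  `Families/ConvergentSymmetries.lean` treats the BASIC integrals (`Convergent σ`).  For a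
GENERALISED cellular family `f_σ(a,b) ω_σ` the designers compute the convergence polytope `BrownConvergent σ a b` per
configuration; this file records, for every `n` and all exponents, that Brown's chord valuation `twoOrd` and hence the
polytope are unchanged when the two polygons are relabeled by a dihedral symmetry, with the exponents carried along:
* `twoOrd_comp_add` / `brownConvergent_comp_add_iff'` — rotate the positions (`σ ↦ σ ∘ (· + c)`, `b ↦ b ∘ (· + c)`);
* `twoOrd_comp_sub` / `brownConvergent_comp_sub_iff'` — reflect the positions (`σ ↦ σ ∘ (c − ·)`, `b_i ↦ b_{c−1−i}`);
* `twoOrd_add` / `brownConvergent_add_iff'` — rotate the places (`σ ↦ σ + c`, `a ↦ a ∘ (· − c)`, chord `p ↦ p + c`);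
* `twoOrd_sub` / `brownConvergent_sub_iff'` — reflect the places (`σ ↦ c − σ`, `a_w ↦ a_{c−1−w}`, chord
  `{p,…,p+k−1} ↦ {c−p−(k−1),…,c−p}`);
with the chord bookkeeping `sameSide_comm`, `sameSide_add`, `sameSide_sub`. [Brown2016, §3.1 (3.4)–(3.5), §3.4 (3.8)]
(These are the combinatorial shadows of the relabeling symmetries of `M_{0,n}`; no statement about the integrals
themselves is made.)
-/
namespace Summit.KontsevichZagierPeriods.Zeta5Search.Families.Cellular

open Finset

variable {ℓ : ℕ}

section ExpSymm

open Fin.NatCast Fin.CommRing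

/-- `sameSide` is symmetric in the two vertices. -/
theorem sameSide_comm (p k : ℕ) (u v : Fin (ℓ + 3)) : sameSide (ℓ := ℓ) p k u v = sameSide p k v u := by
  unfold sameSide
  simp only [iff_comm]

/-- Rotating the places: the chord `(p + c, k)` sees `u + c, v + c` exactly as the chord `(p, k)` sees `u, v`. -/
theorem sameSide_add (p c u v : Fin (ℓ + 3)) (k : ℕ) :
    sameSide (ℓ := ℓ) ((p + c : Fin (ℓ + 3)) : ℕ) k (u + c) (v + c) = sameSide (p : ℕ) k u v := by
  rw [sameSide_eq_ite, sameSide_eq_ite]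
  simp only [add_mem_arc_add_iff]

/-- Reflecting the places `v ↦ c − v`: the chord `(c − p − (k−1), k)` sees `c − u, c − v` exactly as `(p, k)` sees
`u, v` (`1 ≤ k ≤ n`). -/
theorem sameSide_sub (p c u v : Fin (ℓ + 3)) {k : ℕ} (h1 : 1 ≤ k) (hk : k ≤ ℓ + 3) :
    sameSide (ℓ := ℓ) ((c - p - ((k - 1 : ℕ) : Fin (ℓ + 3)) : Fin (ℓ + 3)) : ℕ) k (c - u) (c - v) =
      sameSide (p : ℕ) k u v := by
  have key : ∀ w : Fin (ℓ + 3), c - w ∈ arc (c - p - ((k - 1 : ℕ) : Fin (ℓ + 3))) k ↔ w ∈ arc p k := by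
    intro w
    rw [sub_mem_arc_iff _ w c h1 hk,
      show c - (c - p - ((k - 1 : ℕ) : Fin (ℓ + 3))) - ((k - 1 : ℕ) : Fin (ℓ + 3)) = p by abel]
  rw [sameSide_eq_ite, sameSide_eq_ite]
  simp only [key]

/-- **Rotating the POSITIONS** (`σ ↦ σ ∘ (· + c)`, the `σδ⁰`-exponents carried along, `δ⁰`-exponents unchanged) leaves
every chord valuation unchanged. [Brown2016, §3.1 (3.4), §3.4] -/
theorem twoOrd_comp_add (σ : Fin (ℓ + 3) → Fin (ℓ + 3)) (a b : Fin (ℓ + 3) → ℤ) (c : Fin (ℓ + 3)) (p k : ℕ) :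
    twoOrd (fun i => σ (i + c)) a (fun i => b (i + c)) p k = twoOrd σ a b p k := by
  unfold twoOrd
  congr 2
  exact Fintype.sum_equiv (Equiv.addRight c) _ _ fun i => by
    simp only [Equiv.coe_addRight, add_right_comm i 1 c]

/-- **Rotating the PLACES** (`σ ↦ σ + c`, the `δ⁰`-exponents carried along `a ↦ a ∘ (· − c)`, chords shifted by `c`)
leaves every chord valuation unchanged. [Brown2016, §3.1 (3.5), §3.4] -/
theorem twoOrd_add (σ : Fin (ℓ + 3) → Fin (ℓ + 3)) (a b : Fin (ℓ + 3) → ℤ) (c p : Fin (ℓ + 3)) (k : ℕ) :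
    twoOrd (fun i => σ i + c) (fun v => a (v - c)) b ((p + c : Fin (ℓ + 3)) : ℕ) k = twoOrd σ a b (p : ℕ) k := by
  unfold twoOrd
  congr 2
  · exact Fintype.sum_equiv (Equiv.subRight c) _ _ fun v => by
      simp only [Equiv.subRight_apply]
      rw [← sameSide_add p c (v - c) (v - c + 1) k, show v - c + c = v by abel,
        show v - c + 1 + c = v + 1 by abel]
  · exact Finset.sum_congr rfl fun i _ => by rw [sameSide_add]

/-- **Reflecting the POSITIONS** (`σ ↦ σ ∘ (c − ·)`; the `σδ⁰`-edge at `i` becomes the edge at `c − 1 − i`, read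
backwards) leaves every chord valuation unchanged. [Brown2016, §3.1 (3.4), §3.4] -/
theorem twoOrd_comp_sub (σ : Fin (ℓ + 3) → Fin (ℓ + 3)) (a b : Fin (ℓ + 3) → ℤ) (c : Fin (ℓ + 3)) (p k : ℕ) :
    twoOrd (fun i => σ (c - i)) a (fun i => b (c - 1 - i)) p k = twoOrd σ a b p k := by
  unfold twoOrd
  congr 2
  refine Fintype.sum_equiv (Equiv.subLeft (c - 1)) _ _ fun i => ?_
  simp only [Equiv.subLeft_apply]
  rw [sameSide_comm, show c - 1 - i + 1 = c - i by abel, show c - (i + 1) = c - 1 - i by abel]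

/-- **Reflecting the PLACES** (`σ ↦ c − σ`; the `δ⁰`-edge `{v, v+1}` becomes the edge at `c − 1 − v`; the chord
`{p,…,p+k−1}` becomes `{c−p−(k−1),…,c−p}`) leaves every chord valuation unchanged (`1 ≤ k ≤ n`). [Brown2016, §3.1 (3.5)] -/
theorem twoOrd_sub (σ : Fin (ℓ + 3) → Fin (ℓ + 3)) (a b : Fin (ℓ + 3) → ℤ) (c p : Fin (ℓ + 3)) {k : ℕ}
    (h1 : 1 ≤ k) (hk : k ≤ ℓ + 3) :
    twoOrd (fun i => c - σ i) (fun w => a (c - 1 - w)) b ((c - p - ((k - 1 : ℕ) : Fin (ℓ + 3)) : Fin (ℓ + 3)) : ℕ) k =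
      twoOrd σ a b (p : ℕ) k := by
  unfold twoOrd
  congr 2
  · refine Fintype.sum_equiv (Equiv.subLeft (c - 1)) _ _ fun w => ?_
    simp only [Equiv.subLeft_apply]
    rw [← sameSide_sub p c (c - 1 - w) (c - 1 - w + 1) h1 hk, sameSide_comm,
      show c - (c - 1 - w + 1) = w by abel, show c - (c - 1 - w) = w + 1 by abel]
  · exact Finset.sum_congr rfl fun i _ => by rw [sameSide_sub _ _ _ _ h1 hk]

end ExpSymm

/-- Brown's convergence condition for GENERAL exponents is invariant under rotating the positions (with the
`σδ⁰`-exponents carried along). -/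
theorem brownConvergent_comp_add_iff' (σ : Fin (ℓ + 3) → Fin (ℓ + 3)) (a b : Fin (ℓ + 3) → ℤ) (c : Fin (ℓ + 3)) :
    BrownConvergent (fun i => σ (i + c)) a (fun i => b (i + c)) ↔ BrownConvergent σ a b := by
  unfold BrownConvergent
  simp only [twoOrd_comp_add]

/-- … under reflecting the positions. -/
theorem brownConvergent_comp_sub_iff' (σ : Fin (ℓ + 3) → Fin (ℓ + 3)) (a b : Fin (ℓ + 3) → ℤ) (c : Fin (ℓ + 3)) :
    BrownConvergent (fun i => σ (c - i)) a (fun i => b (c - 1 - i)) ↔ BrownConvergent σ a b := by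
  unfold BrownConvergent
  simp only [twoOrd_comp_sub]

/-- … under rotating the places (with the `δ⁰`-exponents carried along). -/
theorem brownConvergent_add_iff' (σ : Fin (ℓ + 3) → Fin (ℓ + 3)) (a b : Fin (ℓ + 3) → ℤ) (c : Fin (ℓ + 3)) :
    BrownConvergent (fun i => σ i + c) (fun v => a (v - c)) b ↔ BrownConvergent σ a b := by
  unfold BrownConvergent
  constructor
  · intro h p k'
    rw [← twoOrd_add σ a b c p]
    exact h (p + c) k'
  · intro h p k'
    have := h (p - c) k'
    rwa [← twoOrd_add σ a b c (p - c), sub_add_cancel] at this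

section ExpSymm2

open Fin.NatCast Fin.CommRing

/-- … under reflecting the places (with the `δ⁰`-exponents carried along). -/
theorem brownConvergent_sub_iff' (σ : Fin (ℓ + 3) → Fin (ℓ + 3)) (a b : Fin (ℓ + 3) → ℤ) (c : Fin (ℓ + 3)) :
    BrownConvergent (fun i => c - σ i) (fun w => a (c - 1 - w)) b ↔ BrownConvergent σ a b := by
  unfold BrownConvergent
  constructor
  · intro h p k'
    have hk' := k'.isLt
    rw [← twoOrd_sub σ a b c p (k := (k' : ℕ) + 2) (by omega) (by omega)]
    exact h _ k'
  · intro h p k'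
    have hk' := k'.isLt
    have := h (c - p - (((k' : ℕ) + 2 - 1 : ℕ) : Fin (ℓ + 3))) k'
    rwa [← twoOrd_sub σ a b c (c - p - (((k' : ℕ) + 2 - 1 : ℕ) : Fin (ℓ + 3))) (k := (k' : ℕ) + 2) (by omega) (by omega),
      show c - (c - p - (((k' : ℕ) + 2 - 1 : ℕ) : Fin (ℓ + 3))) - (((k' : ℕ) + 2 - 1 : ℕ) : Fin (ℓ + 3)) = p by abel]
      at this

end ExpSymm2

end Summit.KontsevichZagierPeriods.Zeta5Search.Families.Cellular
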